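/- Copyright: the b2b-balaban cell (near-miss cell 7), T⁴-continuum fan-out; row NE7b CRUX team (2), seat
t4-ne7b-formalise-leaf-02 (gen 28; the row owner's INTERFACE REQUEST NE7b IR-46-1 (A) «the bridge to the owner's `fshareP`»,
HOME/INBOX.md l.8971–8981; E-side supplier brick under RULING R-OWNER-46-1 «M5-4 THE FIBRE READING»).  Released under the
licence of the surrounding project. -/
import Summits.QuantumFields.BalabanUV.T4Continuum.Support.HistoryBankingFibreRoom
import Summits.QuantumFields.BalabanUV.T4Continuum.Support.HistoryPriceNodeSum

/-!
# The fibre share READ ON THE KEY: the owner's `fshareP` on the geometric genealogy is the node sum of the letter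
`sharpT φB φR` over the canonical ∕ flat genealogy (INTERFACE REQUEST NE7b IR-46-1 (A), E-side)

Summits-side support leaf of the T⁴-continuum cell (rung (B)+1 on a FINITE torus only; NOT infinite volume, NOT the
mass gap, NOT the Clay statement; NOT a proof of the spine estimate NE7b, which is the cell's OWN estimate, NOT PRINTED
and NOT PROVED).  Row NE7b, route «COUNT» ∕ R-P1, re-open object (α), row S22 «(α)-M5-4 THE FIBRE READING».  [folklore]
elementary bookkeeping; no `[cite:]` tag, nothing printed asserted, no `Prop` fact minted, zero `sorry`.

WHY.  R-OWNER-46-1 sets `RfM K k := MULT K k := ∏_{w ∈ k} exp (node sum of the fibre share over w.2.1)` — a product over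
the KEY family, whose genealogy letter is the FLAT `Pedigree.gen c` — while the owner's M5-4a (`HistoryBankingFibreRoom`,
p274013) books the share on the GEOMETRIC genealogy as `fshareP φB φR (pedMV.toPGen id (K, x))` (births `φB j d′`,
renewals `φR h`, joins nothing).  The requested letter `fshareE φB φR e := if kind = 0 then φB step fat else if kind = 1
then φR (step − 1) else 0` IS `HistoryBankingDiscountCharge.sharpT φB φR` letter for letter, so no new letter is minted.
THIS FILE (§1) proves the two readings agree: `fshareP φB φR P = nsum (sharpT φB φR) P.toGen` (three-case structural
induction; the canonical labels `(j,0,d)` ∕ `(h+1,1,0)` ∕ `(s,2,0)` of `HistoryAdmissible.PGen.toGen`) and hence, for a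
pedigree with the renewal-step clause, `fshareP φB φR (P.toPGen cell c) = nsum (sharpT φB φR) (P.gen c)`
(`HistoryGenTimed.relabel_shape_genT` + `HistoryGenAdm.shape_genT_eq_toGen`: `P.gen c = (P.toPGen cell c).toGen`), so that
`exp (fshareP …)` member by member is module B′'s `MULTOf (sharpT φB φR)` read on the key
(`HistoryPriceKeys.MULTOf_kmemOf_eq_prod_liveC` with `credits (sharpT φB φR ∘ Prod.fst) (genT c) = nsum … (gen c)`,
`HistoryPriceNodeSum.credits_eq_nsum` + `nsum_gmap`); and (§2) supplies the per-member CHARGE with the share booked ON THE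
TAGGED GENEALOGY — `credits (pcredit ∘ sh) G + Ξ G + credits (sharpT φB φR ∘ sh) G ≤ credits (sharpT sB sR ∘ sh) G` from
`RoundingRoomF` (gen 45's `credits_add_discount_le_sharps` at the reduced sharps + `sharpT_sub`) — the hypothesis of
`HistoryPriceKeys.priceM_of_keys_of_charge`, so that `priceM` at `FcM := LIVEOf`, `RfM := MULTOf` needs neither `PGen`
nor letter inflation (located finding F-ne7bleaf02g28-2; the inflation road of M5-4a stays an equivalent alternative).

HONEST.  Bookkeeping identities on OUR objects; no reading of Bałaban, no estimate; (ρ) `FibreMass`, `RoundingRoomF`, `W∞`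
stay R-class displays of the custodian's module P; NE7b NOT PRINTED ∕ NOT PROVED; spine 0∕9.  HONEST DEPENDENCY (cell):
continuum YM on T⁴ ⇐ BetaPertH ∧ nine spine estimates (0/9 proved); BetaPertH ⇐ (D1) ∧ (D4) ∧ CAP+tail; G-an2-4 gates
asym, D1 and NE2/3/4.  This file changes none of it. -/

open Finset
open Literature.MathematicalPhysics.QuantumFieldTheory.Balaban1983to89
open T4PersistenceDictionary T4PrintedShapeBanking T4TaggedShapeBanking T4BankedInduction T4PartnerMultiplicity
open Summit.QuantumFields.BalabanUV.T4Continuum.HistoryAdmissible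
open Summit.QuantumFields.BalabanUV.T4Continuum.HistoryGen
open Summit.QuantumFields.BalabanUV.T4Continuum.ZoneSkeleton
open Summit.QuantumFields.BalabanUV.T4Continuum.HistoryConstants
open Summit.QuantumFields.BalabanUV.T4Continuum.HistoryBankingLE
open Summit.QuantumFields.BalabanUV.T4Continuum.HistoryBankingDiscountCharge
open Summit.QuantumFields.BalabanUV.T4Continuum.HistoryBankingFibreRoom
open Summit.QuantumFields.BalabanUV.T4Continuum.HistoryPriceNodeSum

namespace Summit.QuantumFields.BalabanUV.T4Continuum.HistoryPriceShareBridge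

noncomputable section

variable {γ : Type*} (φB : ℕ → ℕ → ℝ) (φR : ℕ → ℝ)

/-- **THE FIBRE SHARE OF A GEOMETRIC GENEALOGY IS THE NODE SUM OF `sharpT φB φR` OVER ITS CANONICAL LABEL** (births
`(j,0,d′) ↦ φB j d′`, renewals `(h+1,1,0) ↦ φR h`, joins `(s,2,0) ↦ 0`). [folklore] -/
theorem fshareP_eq_nsum_toGen : ∀ P : PGen γ, fshareP φB φR P = nsum (sharpT φB φR) P.toGen
  | PGen.birth j d _ => by
      rw [fshareP, PGen.toGen, nsum_born, sharpT_kind0 (by rfl)]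
      rfl
  | PGen.renew G h => by
      rw [fshareP, PGen.toGen, nsum_renew, fshareP_eq_nsum_toGen G, sharpT_kind1 (by rfl), add_comm]
      rfl
  | PGen.join X Y s => by
      rw [fshareP, PGen.toGen, nsum_merge, fshareP_eq_nsum_toGen X, fshareP_eq_nsum_toGen Y, sharpT_kind2 (by rfl),
        add_zero]

variable {α π : Type*} [DecidableEq α] [DecidableEq π] [Inhabited γ]

/-- **ON A PEDIGREE WITH THE RENEWAL-STEP CLAUSE, THE FLAT GENEALOGY OF A COMPONENT IS THE CANONICAL LABEL OF ITS GEOMETRIC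
GENEALOGY** (`relabel_shape_genT` + `shape_genT_eq_toGen`). [folklore] -/
theorem gen_eq_toGen_toPGen (P : Pedigree α π) (cell : π → γ)
    (hS : ∀ c c', Part.old c' true ∈ P.parts c → P.step c' + 1 = P.step c) (c : α) :
    P.gen c = (P.toPGen cell c).toGen :=
  (P.relabel_shape_genT c).symm.trans (P.shape_genT_eq_toGen cell hS c)

/-- **THE FIBRE SHARE OF A COMPONENT's GEOMETRIC GENEALOGY READ ON THE KEY**: `fshareP φB φR (P.toPGen cell c) =
nsum (sharpT φB φR) (P.gen c)` — the letter of module B′'s `MULTOf (sharpT φB φR)`. [folklore] -/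
theorem fshareP_toPGen_eq_nsum_gen (P : Pedigree α π) (cell : π → γ)
    (hS : ∀ c c', Part.old c' true ∈ P.parts c → P.step c' + 1 = P.step c) (c : α) :
    fshareP φB φR (P.toPGen cell c) = nsum (sharpT φB φR) (P.gen c) := by
  rw [fshareP_eq_nsum_toGen, gen_eq_toGen_toPGen P cell hS c]

/-- **… AND AS THE TAGGED CREDITS OF THE SHARE LETTER** on a well-formed tagged genealogy:
`fshareP φB φR (P.toPGen cell c) = credits (sharpT φB φR ∘ Prod.fst) (P.genT c)` (the form module B′'s
`MULTOf_kmemOf_eq_prod_liveC` produces). [folklore] -/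
theorem fshareP_toPGen_eq_credits_genT (P : Pedigree α π) (cell : π → γ)
    (hS : ∀ c c', Part.old c' true ∈ P.parts c → P.step c' + 1 = P.step c) (c : α) {W' : Lab α π → ℕ}
    (hW : (P.genT c).WF W') :
    fshareP φB φR (P.toPGen cell c) = credits (sharpT φB φR ∘ Prod.fst) (P.genT c) := by
  rw [fshareP_toPGen_eq_nsum_gen φB φR P cell hS c, credits_eq_nsum _ hW, ← nsum_gmap Prod.fst (sharpT φB φR) (P.genT c)]
  rfl

/-! ## §2 The CHARGE with the fibre share booked, on the tagged genealogy (the per-member hypothesis of module B′'s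
`priceM_of_keys_of_charge`, from the owner's `RoundingRoomF`) -/

section Charge

omit [Inhabited γ]

/-- **the per-letter table is linear in its two tables**: `sharpT (sB − φB) (sR − φR) = sharpT sB sR − sharpT φB φR`.
[folklore] -/
theorem sharpT_sub (sB φB' : ℕ → ℕ → ℝ) (sR φR' : ℕ → ℝ) (e : PEv) :
    sharpT (fun j d => sB j d - φB' j d) (fun h => sR h - φR' h) e = sharpT sB sR e - sharpT φB' φR' e := by
  unfold sharpT
  split_ifs <;> simp

variable {ε : Type*} [DecidableEq ε] {sh : ε → PEv} {C : T4PrintedShapeBanking.Consts} {O : PrintedO1s} {L K : ℕ}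
  {R : ℕ → ℕ} {g : ℕ → ℝ} {β' β₀ : ℝ} {sB : ℕ → ℕ → ℝ} {sR : ℕ → ℝ} {φB' : ℕ → ℕ → ℝ} {φR' : ℕ → ℝ}

/-- **THE CHARGE WITH THE FIBRE SHARE BOOKED, ON THE TAGGED GENEALOGY**: under the owner's booked junction `RoundingRoomF`
(M5-4a), (2.9) on the run, `L ≥ 1`, `E₂ > 0`, `E₃ ≥ 0`, for every `ConsistentTLE` well-formed `G`:
`credits (pcredit ∘ sh) G + Ξ G + credits (sharpT φB φR ∘ sh) G ≤ credits (sharpT sB sR ∘ sh) G` — gen 45's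
`credits_add_discount_le_sharps` at the reduced sharps (`RoundingRoomF.toRoundingRoom`) + linearity of `sharpT`.  This is
the hypothesis `hch` of `HistoryPriceKeys.priceM_of_keys_of_charge` at `σ := sharpT sB sR`, `φ := sharpT φB φR`: NO `PGen`,
NO letter inflation on this road. [folklore] -/
theorem credits_add_discount_add_share_le_sharps (h29 : B14FlowStep.FlowIneq29 R g L β' β₀ K) (hL : 1 ≤ L)
    (hE₂ : 0 < C.E₂) (hE₃ : 0 ≤ C.E₃) (hRR : RoundingRoomF C O L K R g sB sR φB' φR') {G : Gen ε}
    (hW : G.WF (dictWT sh R C.n₁)) (hc : ConsistentTLE sh C K R G) :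
    credits (pcredit O C g ∘ sh) G +
        (8 / C.E₂ * totalCostT sh C K R G + 4 * (partnerAges (PEv.step ∘ sh) G : ℝ)) +
        credits (sharpT φB' φR' ∘ sh) G ≤
      credits (sharpT sB sR ∘ sh) G := by
  have h := credits_add_discount_le_sharps h29 hL hE₂ hE₃ hRR.toRoundingRoom hW hc
  have hsplit : ∑ e ∈ G.events, sharpT (fun j d => sB j d - φB' j d) (fun h => sR h - φR' h) (sh e) =
      credits (sharpT sB sR ∘ sh) G - credits (sharpT φB' φR' ∘ sh) G := by
    simp only [credits, Function.comp_apply, sharpT_sub, sum_sub_distrib]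
  rw [hsplit] at h
  linarith

end Charge

end

end Summit.QuantumFields.BalabanUV.T4Continuum.HistoryPriceShareBridge
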